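import Summits.CriticalPhenomena.CardyFormulaZ2.Theorems.CardySelfRefinementLagHandOffNoTraceVisit
import HarnessLib

/-!
# No sliding of the limit interface, part 2: straight stretches of a curve and the net of
visited chains

Helper file for the registered stub `stub_quadTransfer_noSliding` of line `hitting-tournament`
of crux `LagHandOff` (stmt-CriticalPhenomena-10268), namespace
`Summit.CriticalPhenomena.CardyFormulaZ2.Cruxes.LagHandOff.HittingTournament`.  Deterministic
plane geometry of the "no sliding" clause: a curve class none of whose representatives `c` has
a non-trivial parameter stretch `[s, t]` on which `Re(ū c)` is constant (`‖u‖ = 1`).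

* Frame coordinates `z = u (p + i q)`, `p = Re(ū z)`, `q = Im(ū z)` (`frame_decomp`,
  `dist_frame_le`, `dist_frame_same`, `abs_le_norm_frame`).
* `exists_segment_of_straightStretch` (registered sub-stub `stub_noSliding_segment`) — for a curve of `D̄` tracing no boundary arc, a
  violating stretch (constant `p`-coordinate `p₀`, not constant) passes through EVERY point of a
  non-degenerate segment `{u(p₀ + iy) : y ∈ [a, a + ℓ]}` whose `3ℓ`-neighbourhood lies in the
  open domain `D` (the stretch is a connected subset of the line `p = p₀` with two points; if it
  lay on `∂D` the no-tracing clause would make it a point; a point of it in `D` and the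
  intermediate value theorem for `q ∘ c` give the segment).
* `exists_net_of_segment` — rounding to the net: with `ρ = ℓ/(40N)`, the chain
  `z_j = u(k₁ρ/2 + i(k₂ρ/2 + 40ρj))`, `j ≤ N`, `k₁ = round(2p₀/ρ)`, `k₂ = round(2a/ρ)`
  (`|k₁|, |k₂| ≤ ⌈2 Rad/ρ⌉ + 1` when the trace lies in `B̄(0, Rad)`) has every point within
  `ρ/2` of a point of the segment, hence within `ρ` of the trace and at distance `≥ 44ρ` from
  `∂D`.
* `isOpen_setOf_exists_forall_infDist_lt` — the event "the trace comes within `ρ` of every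
  point of some admissible chain of the net" is open in the curve space (the distance from a
  point to the trace is continuous, `continuous_infDist_range`).

References: M. Aizenman, A. Burchard, Duke Math. J. 99 (1999), §2.1 (functionals of the trace on
the curve space); elementary plane geometry.
-/

noncomputable section

open MeasureTheory Filter Set Topology Metric
open scoped unitInterval
open Literature.Probability.Percolation Literature.Probability.LatticeModels
open Literature.Probability.RandomPlanarGeometry

namespace Summit.CriticalPhenomena.CardyFormulaZ2.Cruxes.LagHandOff.HittingTournament

/-! ### Frame coordinates attached to a unit vector -/

section Frame

variable {u : ℂ}

/-- `u ū = 1` for a unit complex number. -/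
theorem mul_conj_of_norm_eq_one (hu : ‖u‖ = 1) : u * (starRingEnd ℂ) u = 1 := by
  rw [Complex.mul_conj, Complex.normSq_eq_norm_sq, hu]
  simp

/-- Frame decomposition: `z = u (Re(ū z) + i Im(ū z))`. -/
theorem frame_decomp (hu : ‖u‖ = 1) (z : ℂ) :
    u * ((((starRingEnd ℂ) u * z).re : ℂ) + (((starRingEnd ℂ) u * z).im : ℂ) * Complex.I) = z := by
  rw [Complex.re_add_im, ← mul_assoc, mul_conj_of_norm_eq_one hu, one_mul]

/-- Distances in frame coordinates are at most the `ℓ¹` distance of the coordinates. -/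
theorem dist_frame_le (hu : ‖u‖ = 1) (p q p' q' : ℝ) :
    dist (u * ((p : ℂ) + (q : ℂ) * Complex.I)) (u * ((p' : ℂ) + (q' : ℂ) * Complex.I)) ≤
      |p - p'| + |q - q'| := by
  rw [Complex.dist_eq, ← mul_sub, norm_mul, hu, one_mul]
  have : ((p : ℂ) + (q : ℂ) * Complex.I) - ((p' : ℂ) + (q' : ℂ) * Complex.I) =
      ((p - p' : ℝ) : ℂ) + ((q - q' : ℝ) : ℂ) * Complex.I := by
    push_cast
    ring
  rw [this]
  refine (norm_add_le _ _).trans ?_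
  rw [norm_mul, Complex.norm_I, mul_one, Complex.norm_real, Complex.norm_real, Real.norm_eq_abs,
    Real.norm_eq_abs]

/-- Points with the same `p`-coordinate are at distance the difference of their
`q`-coordinates. -/
theorem dist_frame_same (hu : ‖u‖ = 1) (p q q' : ℝ) :
    dist (u * ((p : ℂ) + (q : ℂ) * Complex.I)) (u * ((p : ℂ) + (q' : ℂ) * Complex.I)) =
      |q - q'| := by
  rw [Complex.dist_eq, ← mul_sub, norm_mul, hu, one_mul]
  have : ((p : ℂ) + (q : ℂ) * Complex.I) - ((p : ℂ) + (q' : ℂ) * Complex.I) =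
      ((q - q' : ℝ) : ℂ) * Complex.I := by
    push_cast
    ring
  rw [this, norm_mul, Complex.norm_I, mul_one, Complex.norm_real, Real.norm_eq_abs]

/-- Both frame coordinates are bounded by the norm. -/
theorem abs_le_norm_frame (hu : ‖u‖ = 1) (p q : ℝ) :
    |p| ≤ ‖u * ((p : ℂ) + (q : ℂ) * Complex.I)‖ ∧ |q| ≤ ‖u * ((p : ℂ) + (q : ℂ) * Complex.I)‖ := by
  rw [norm_mul, hu, one_mul]
  constructor
  · simpa using Complex.abs_re_le_norm ((p : ℂ) + (q : ℂ) * Complex.I)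
  · simpa using Complex.abs_im_le_norm ((p : ℂ) + (q : ℂ) * Complex.I)

end Frame

/-! ### The event of the net is open -/

/-- **The net event is open in the curve space.** For finitely many indices `i ∈ s`, side
conditions `Q i` and chains `z i : ℕ → ℂ`, the set of curve classes whose trace comes within
`ρ` of every point `z i j`, `j ≤ N`, of some chain with `Q i`, is open. -/
theorem isOpen_setOf_exists_forall_infDist_lt {ι : Type*} (s : Finset ι) (Q : ι → Prop)
    (z : ι → ℕ → ℂ) (N : ℕ) (ρ : ℝ) :
    IsOpen {γ : CurveClass ℂ | ∃ i ∈ s, Q i ∧ ∀ j ≤ N, infDist (z i j) γ.range < ρ} := by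
  have h : {γ : CurveClass ℂ | ∃ i ∈ s, Q i ∧ ∀ j ≤ N, infDist (z i j) γ.range < ρ} =
      ⋃ i ∈ s, ({γ | Q i} ∩ ⋂ j ∈ Finset.range (N + 1), {γ | infDist (z i j) γ.range < ρ}) := by
    ext γ
    simp only [mem_setOf_eq, mem_iUnion, mem_inter_iff, mem_iInter, Finset.mem_range,
      Nat.lt_succ_iff, exists_prop]
  rw [h]
  exact isOpen_biUnion fun i _ => isOpen_const.inter
    (isOpen_biInter_finset fun j _ => isOpen_lt (continuous_infDist_range _) continuous_const)

/-! ### A violating straight stretch passes through a bulk segment -/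

/-- **A non-constant stretch with constant `p`-coordinate, of a curve of `D̄` tracing no
boundary arc, passes through every point of a bulk segment.** Let `c` have trace in `D̄`, trace
no non-degenerate sub-arc of `∂D` on any parameter interval, and on `[s, t]` (`s < t`) have
constant `Re(ū c) = p₀` without being constant.  Then there are `a` and `ℓ > 0` such that every
point `u(p₀ + iy)`, `y ∈ [a, a + ℓ]`, is on the curve and has its `3ℓ`-ball inside `D`. -/
theorem exists_segment_of_straightStretch (D : DobrushinDomain) {u : ℂ} (hu : ‖u‖ = 1)
    {c : Curve ℂ} (hcl : ∀ r, c r ∈ closure D.carrier)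
    (hnt : ∀ s t : I, s < t → c '' Icc s t ⊆ frontier D.carrier → (c '' Icc s t).Subsingleton)
    {s t : I} (hst : s < t)
    (hconst : ∀ r ∈ Icc s t, ((starRingEnd ℂ) u * c r).re = ((starRingEnd ℂ) u * c s).re)
    {r₀ : I} (hr₀ : r₀ ∈ Icc s t) (hne : c r₀ ≠ c s) :
    ∃ p₀ a ℓ : ℝ, 0 < ℓ ∧ ∀ y ∈ Icc a (a + ℓ),
      (∃ r, c r = u * ((p₀ : ℂ) + (y : ℂ) * Complex.I)) ∧
        ball (u * ((p₀ : ℂ) + (y : ℂ) * Complex.I)) (3 * ℓ) ⊆ D.carrier := by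
  set p₀ : ℝ := ((starRingEnd ℂ) u * c s).re with hp₀
  set g : I → ℝ := fun r => ((starRingEnd ℂ) u * c r).im with hg
  have hgc : Continuous g := Complex.continuous_im.comp (continuous_const.mul c.continuous)
  have hrepr : ∀ r ∈ Icc s t, c r = u * ((p₀ : ℂ) + (g r : ℂ) * Complex.I) := by
    intro r hr
    rw [← hconst r hr]
    exact (frame_decomp hu (c r)).symm
  have hs : s ∈ Icc s t := ⟨le_rfl, hst.le⟩
  -- a point of the stretch inside `D`
  obtain ⟨r₁, hr₁, hr₁D⟩ : ∃ r₁ ∈ Icc s t, c r₁ ∈ D.carrier := by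
    by_contra hall
    push Not at hall
    have hsub : c '' Icc s t ⊆ frontier D.carrier := by
      rintro _ ⟨r, hr, rfl⟩
      rw [D.isOpen.frontier_eq]
      exact ⟨hcl r, hall r hr⟩
    exact hne ((hnt s t hst hsub) ⟨r₀, hr₀, rfl⟩ ⟨s, hs, rfl⟩)
  obtain ⟨ε, hε, hball⟩ := Metric.isOpen_iff.1 D.isOpen (c r₁) hr₁D
  -- a second level of the `q`-coordinate
  obtain ⟨r₂, hr₂, hy₂⟩ : ∃ r₂ ∈ Icc s t, g r₂ ≠ g r₁ := by
    by_cases h : g s = g r₁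
    · refine ⟨r₀, hr₀, fun h' => hne ?_⟩
      rw [hrepr r₀ hr₀, hrepr s hs, h', h]
    · exact ⟨s, hs, h⟩
  -- every level between `g r₁` and `g r₂` is attained on `[s, t]`
  have hlev : ∀ y ∈ uIcc (g r₁) (g r₂), ∃ r, c r = u * ((p₀ : ℂ) + (y : ℂ) * Complex.I) := by
    intro y hy
    obtain ⟨r, hr, hry⟩ := intermediate_value_uIcc hgc.continuousOn hy
    have hr' : r ∈ Icc s t := uIcc_subset_Icc hr₁ hr₂ hr
    exact ⟨r, by rw [hrepr r hr', ← hry]⟩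
  set ℓ := min (ε / 4) |g r₂ - g r₁| with hℓ
  have hℓpos : 0 < ℓ := lt_min (by positivity) (abs_pos.2 (sub_ne_zero.2 hy₂))
  have hℓε : ℓ ≤ ε / 4 := min_le_left _ _
  have hℓy : ℓ ≤ |g r₂ - g r₁| := min_le_right _ _
  -- the start of the segment
  obtain ⟨a, hay, hdist⟩ : ∃ a : ℝ, Icc a (a + ℓ) ⊆ uIcc (g r₁) (g r₂) ∧
      ∀ y ∈ Icc a (a + ℓ), |y - g r₁| ≤ ℓ := by
    rcases lt_or_gt_of_ne hy₂ with h | h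
    · -- `g r₂ < g r₁`
      rw [abs_of_neg (sub_neg.2 h)] at hℓy
      refine ⟨g r₁ - ℓ, fun y hy => ?_, fun y hy => ?_⟩
      · rw [uIcc_of_ge h.le]
        exact ⟨by linarith [hy.1], by linarith [hy.2]⟩
      · rw [abs_le]
        constructor <;> linarith [hy.1, hy.2]
    · rw [abs_of_pos (sub_pos.2 h)] at hℓy
      refine ⟨g r₁, fun y hy => ?_, fun y hy => ?_⟩
      · rw [uIcc_of_le h.le]
        exact ⟨hy.1, by linarith [hy.2]⟩
      · rw [abs_le]
        constructor <;> linarith [hy.1, hy.2]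
  refine ⟨p₀, a, ℓ, hℓpos, fun y hy => ⟨hlev y (hay hy), fun w hw => hball ?_⟩⟩
  rw [mem_ball] at hw ⊢
  have h1 : dist (u * ((p₀ : ℂ) + (y : ℂ) * Complex.I)) (c r₁) ≤ ℓ := by
    rw [hrepr r₁ hr₁, dist_frame_same hu]
    exact hdist y hy
  linarith [dist_triangle w (u * ((p₀ : ℂ) + (y : ℂ) * Complex.I)) (c r₁)]

/-- **Registered sub-stub `stub_noSliding_segment`** (line `hitting-tournament`, stub
`stub_quadTransfer_noSliding`, helper, part 2): `exists_segment_of_straightStretch` with all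
arguments explicit. -/
theorem stub_noSliding_segment : ∀ (D : DobrushinDomain) (u : ℂ), ‖u‖ = 1 → ∀ (c : Curve ℂ), (∀ r, c r ∈ closure D.carrier) → (∀ s t : unitInterval, s < t → c '' Set.Icc s t ⊆ frontier D.carrier → (c '' Set.Icc s t).Subsingleton) → ∀ (s t : unitInterval), s < t → (∀ r ∈ Set.Icc s t, (starRingEnd ℂ u * c r).re = (starRingEnd ℂ u * c s).re) → ∀ r₀ ∈ Set.Icc s t, c r₀ ≠ c s → ∃ p₀ a ℓ : ℝ, 0 < ℓ ∧ ∀ y ∈ Set.Icc a (a + ℓ), (∃ r, c r = u * ((p₀ : ℂ) + (y : ℂ) * Complex.I)) ∧ Metric.ball (u * ((p₀ : ℂ) + (y : ℂ) * Complex.I)) (3 * ℓ) ⊆ D.carrier :=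
  fun D _ hu _ hcl hnt _ _ hst hconst _ hr₀ hne =>
    exists_segment_of_straightStretch D hu hcl hnt hst hconst hr₀ hne

/-! ### Rounding a bulk segment to a chain of the net -/

/-- **A bulk segment through the trace is shadowed by a chain of the net.** Let the trace `S`
lie in `B̄(0, Rad)` and contain every point `u(p₀ + iy)`, `y ∈ [a, a + ℓ]`, each with its
`3ℓ`-ball inside the open set `D` (whose frontier is nonempty).  For `N ≥ 1` and
`ρ = ℓ/(40N)`, the chain `z_j = u(k₁ρ/2 + i(k₂ρ/2 + 40ρj))`, `j ≤ N`, with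
`k₁ = round(2p₀/ρ)`, `k₂ = round(2a/ρ)`, has `|k₁|, |k₂| ≤ ⌈2 Rad/ρ⌉ + 1`, every `z_j` at
distance `≥ 44ρ` from `∂D`, and every `z_j` within `ρ` of `S`. -/
theorem exists_net_of_segment {u : ℂ} (hu : ‖u‖ = 1) {S D : Set ℂ} (hD : IsOpen D)
    (hfr : (frontier D).Nonempty) {Rad : ℝ} (hRad : S ⊆ closedBall 0 Rad) {p₀ a ℓ : ℝ}
    (hℓ : 0 < ℓ)
    (hseg : ∀ y ∈ Icc a (a + ℓ), u * ((p₀ : ℂ) + (y : ℂ) * Complex.I) ∈ S ∧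
      ball (u * ((p₀ : ℂ) + (y : ℂ) * Complex.I)) (3 * ℓ) ⊆ D)
    {N : ℕ} (hN : 0 < N) {ρ : ℝ} (hρ : ρ = ℓ / (40 * N)) :
    ∃ kk ∈ (Finset.Icc (-((⌈2 * Rad / ρ⌉₊ + 1 : ℕ) : ℤ)) ((⌈2 * Rad / ρ⌉₊ + 1 : ℕ) : ℤ)) ×ˢ
        (Finset.Icc (-((⌈2 * Rad / ρ⌉₊ + 1 : ℕ) : ℤ)) ((⌈2 * Rad / ρ⌉₊ + 1 : ℕ) : ℤ)),
      (∀ j ≤ N, 44 * ρ ≤ infDist (u * ((((kk.1 : ℝ) * ρ / 2 : ℝ) : ℂ) +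
          (((kk.2 : ℝ) * ρ / 2 + 40 * ρ * j : ℝ) : ℂ) * Complex.I)) (frontier D)) ∧
        ∀ j ≤ N, infDist (u * ((((kk.1 : ℝ) * ρ / 2 : ℝ) : ℂ) +
          (((kk.2 : ℝ) * ρ / 2 + 40 * ρ * j : ℝ) : ℂ) * Complex.I)) S < ρ := by
  have hNr : (1 : ℝ) ≤ N := by exact_mod_cast hN
  have hρpos : 0 < ρ := by rw [hρ]; positivity
  have hρℓ : 40 * ρ * N = ℓ := by rw [hρ]; field_simp
  have hρℓ' : 40 * ρ ≤ ℓ := by nlinarith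
  -- the coordinates of the segment are bounded by `Rad`
  have ha : a ∈ Icc a (a + ℓ) := ⟨le_rfl, by linarith⟩
  have hnorm : ‖u * ((p₀ : ℂ) + (a : ℂ) * Complex.I)‖ ≤ Rad := by
    have := hRad (hseg a ha).1
    rwa [mem_closedBall, dist_zero_right] at this
  have hp₀ : |p₀| ≤ Rad := (abs_le_norm_frame hu p₀ a).1.trans hnorm
  have haR : |a| ≤ Rad := (abs_le_norm_frame hu p₀ a).2.trans hnorm
  -- rounding
  set k₁ : ℤ := round (2 * p₀ / ρ) with hk₁
  set k₂ : ℤ := round (2 * a / ρ) with hk₂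
  have hround : ∀ (x : ℝ) (k : ℤ), k = round (2 * x / ρ) → |(k : ℝ) * ρ / 2 - x| ≤ ρ / 4 := by
    intro x k hk
    have h := abs_sub_round (2 * x / ρ)
    rw [← hk] at h
    have : (k : ℝ) * ρ / 2 - x = (ρ / 2) * ((k : ℝ) - 2 * x / ρ) := by
      field_simp
    rw [this, abs_mul, abs_of_pos (by positivity : (0 : ℝ) < ρ / 2), abs_sub_comm]
    nlinarith
  have hgrid : ∀ (x : ℝ) (k : ℤ), k = round (2 * x / ρ) → |x| ≤ Rad →
      |(k : ℝ)| ≤ (⌈2 * Rad / ρ⌉₊ : ℝ) + 1 := by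
    intro x k hk hx
    have h := abs_sub_round (2 * x / ρ)
    rw [← hk] at h
    have h2 : |2 * x / ρ| ≤ 2 * Rad / ρ := by
      rw [abs_div, abs_mul, abs_of_pos hρpos, abs_two]
      gcongr
    have h3 : (2 * Rad / ρ : ℝ) ≤ (⌈2 * Rad / ρ⌉₊ : ℝ) := Nat.le_ceil _
    calc |(k : ℝ)| = |2 * x / ρ - (2 * x / ρ - k)| := by ring_nf
      _ ≤ |2 * x / ρ| + |2 * x / ρ - k| := abs_sub _ _
      _ ≤ (⌈2 * Rad / ρ⌉₊ : ℝ) + 1 := by linarith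
  -- the reference points on the segment
  have href : ∀ j ≤ N, a + 40 * ρ * j ∈ Icc a (a + ℓ) := by
    intro j hj
    have hj' : (j : ℝ) ≤ N := by exact_mod_cast hj
    refine ⟨by nlinarith [(Nat.cast_nonneg j : (0 : ℝ) ≤ j)], ?_⟩
    nlinarith
  have hnear : ∀ j : ℕ, dist (u * ((((k₁ : ℝ) * ρ / 2 : ℝ) : ℂ) +
      (((k₂ : ℝ) * ρ / 2 + 40 * ρ * j : ℝ) : ℂ) * Complex.I))
      (u * ((p₀ : ℂ) + ((a + 40 * ρ * j : ℝ) : ℂ) * Complex.I)) ≤ ρ / 2 := by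
    intro j
    refine (dist_frame_le hu _ _ _ _).trans ?_
    have : (k₂ : ℝ) * ρ / 2 + 40 * ρ * j - (a + 40 * ρ * j) = (k₂ : ℝ) * ρ / 2 - a := by ring
    rw [this]
    linarith [hround p₀ k₁ hk₁, hround a k₂ hk₂]
  refine ⟨(k₁, k₂), ?_, fun j hj => ?_, fun j hj => ?_⟩
  · have e1 := abs_le.1 (hgrid p₀ k₁ hk₁ hp₀)
    have e2 := abs_le.1 (hgrid a k₂ hk₂ haR)
    rw [Finset.mem_product, Finset.mem_Icc, Finset.mem_Icc]
    refine ⟨⟨?_, ?_⟩, ?_, ?_⟩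
    · exact_mod_cast e1.1
    · exact_mod_cast e1.2
    · exact_mod_cast e2.1
    · exact_mod_cast e2.2
  · dsimp only
    obtain ⟨-, hballD⟩ := hseg _ (href j hj)
    refine (le_infDist hfr).2 fun w hw => ?_
    have hwD : w ∉ D := fun h => by
      rw [hD.frontier_eq] at hw
      exact hw.2 h
    have h3 : 3 * ℓ ≤ dist w (u * ((p₀ : ℂ) + ((a + 40 * ρ * j : ℝ) : ℂ) * Complex.I)) := by
      by_contra h
      push Not at h
      exact hwD (hballD (mem_ball.2 h))
    linarith [dist_triangle w (u * ((((k₁ : ℝ) * ρ / 2 : ℝ) : ℂ) +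
      (((k₂ : ℝ) * ρ / 2 + 40 * ρ * j : ℝ) : ℂ) * Complex.I))
      (u * ((p₀ : ℂ) + ((a + 40 * ρ * j : ℝ) : ℂ) * Complex.I)),
      dist_comm w (u * ((((k₁ : ℝ) * ρ / 2 : ℝ) : ℂ) +
        (((k₂ : ℝ) * ρ / 2 + 40 * ρ * j : ℝ) : ℂ) * Complex.I)), hnear j]
  · dsimp only
    obtain ⟨hS, -⟩ := hseg _ (href j hj)
    exact (infDist_le_dist_of_mem hS).trans_lt (by linarith [hnear j])

end Summit.CriticalPhenomena.CardyFormulaZ2.Cruxes.LagHandOff.HittingTournament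

end
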